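import Summits.CriticalPhenomena.PercolationContinuityZ3.Theorems.FK.MagnetizationExponentialLLN
import Summits.CriticalPhenomena.PercolationContinuityZ3.Theorems.FK.EnergyLargeDeviations
import Summits.CriticalPhenomena.PercolationContinuityZ3.Theorems.FK.LatticeEdgeCounting
import HarnessLib

/-!
# THE MAGNETISATION AND ENERGY DENSITIES HAVE BOUNDARY-CONDITION-INDEPENDENT THERMODYNAMIC LIMITS WHEREVER THE PRESSURE IS
# DIFFERENTIABLE: `⟨M_N⟩^{bc}_{Λ_N;β,h}/|Λ_N| → ∂ψ/∂h /β` AND `⟨−H_N⟩^{bc}_{Λ_N;β,h}/|Λ_N| → ∂ψ/∂β` FOR EVERY BOUNDARY CONDITION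
# (Ellis 2006, Thm. II.6.3 and (2.32); Friedli–Velenik 2017, Thm. 3.6 / Cor. 3.44 in density form)

Claimed R42 (8)(c) in the cell INBOX at 2026-08-29T08:22:34Z by fkp-10a gen 359 (NEW CLAIM #4 of the gen), addressed to coordinator fk-4 gen 294 (seated 06:59Z 2026-08-29 by l.8791; R172 l.8793 / R173 l.8802 / R174 l.8806 in force; ruling R175 requested); lineage row FO-10a-g359d (self-suggested), package g359-densities, label LD-H.
Helper file of the `fk-continuity` build cell (bschramm lane; `--supports stmt-CriticalPhenomena-4575`); builds on
p205010 (kernel theorem, internal audit signed; external expert review pending). No definitions, no named facts, no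
sorries; standard axioms. UNCONDITIONAL (nearest-neighbour Ising model on `ℤ^d`, boxes `Λ_N = {−N,…,N}^d`, EVERY boundary
condition `bc` — free, `+`, `−`, or `fixed η` for an ARBITRARY configuration `η`; `μ_N = μ^{bc}_{Λ_N;β,h}`,
`M_N = Σ_{x∈Λ_N} σ_x`, `−H_N = −H^{bc}_{Λ_N;h}`).

Ellis (2.32): if the free energy function is differentiable at `0` then `E{W_n/a_n} → c'(0)`; here the exponential
concentration of `MagnetizationExponentialLLN` / `EnergyLargeDeviations` is turned into convergence of MEANS by the
elementary bound `|E X − D| ≤ ε + B·μ{ε ≤ |X − D|}` for `|X − D| ≤ B` (`abs_integral_sub_le_of_abs_sub_le`):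

* `abs_integral_sub_le_of_abs_sub_le` (pure, any probability space), `tendsto_integral_of_concentration` (pure: bounded
  deviations + concentration ⇒ convergence of means);
* **`tendsto_integral_boxMagnetization_of_hasDerivAt`** — `HasDerivAt ψ(β,·) D h` (`β > 0`, `d ≥ 1`) ⇒
  `|Λ_N|⁻¹ ∫ M_N dμ^{bc}_{Λ_N;β,h} → D/β` for EVERY `bc`; hence `|Λ_N|⁻¹ Σ_{x∈Λ_N} ⟨σ_x⟩^{bc}_{Λ_N;β,h} → D/β`
  (`tendsto_boxAverage_isingCorr_of_hasDerivAt`): THE BOX-AVERAGED ONE-POINT FUNCTION HAS THE SAME LIMIT FOR ALL BOUNDARY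
  CONDITIONS; specialisations **`tendsto_boxAverage_isingCorr_pos_field`** (`→ m(β,h)`, `h > 0`), `…_neg_field`
  (`→ −m(β,−h)`), **`tendsto_boxAverage_isingCorr_zero_field_of_spontaneousMagnetization_eq_zero`** (`→ 0` at `h = 0` when
  `m* = 0`), `…_of_hasUniqueGibbsMeasure` (`→ sign(h) m(β,|h|)` in the uniqueness region), `…_zero_field_of_le_criticalBeta`;
* **`tendsto_integral_energyDensity_of_hasDerivAt`** — `HasDerivAt ψ(·,h) D β` (`d ≥ 1`) ⇒ `|Λ_N|⁻¹ ∫ (−H_N) dμ^{bc}_{Λ_N;β,h} → D`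
  for EVERY `bc`; specialisations `tendsto_integral_energyDensity_of_le_criticalBeta` (`h = 0`, `0 < β ≤ β_c`, `d ≥ 2`:
  `→ Σᵢ⟨σ_0σ_{eᵢ}⟩⁺_β` — at `β_c` included: the mean energy density of EVERY boundary condition converges to the critical
  energy), `…_criticalBeta`, `…_pos_field`, `…_two` (`d = 2`, every `β > 0`).

## References

* R. S. Ellis, *Entropy, Large Deviations, and Statistical Mechanics*, Springer (1985/2006), Thm. II.6.3 and eq. (2.32),
  Thm. IV.5.5, Lemma IV.6.3, §IV.7. [Ellis2006]
* S. Friedli, Y. Velenik, *Statistical Mechanics of Lattice Systems*, CUP (2017), Thm. 3.6, Prop. 3.29, Cor. 3.44,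
  Exercise 3.17. [FriedliVelenik2017]
-/

noncomputable section

namespace Summit.CriticalPhenomena.PercolationContinuityZ3.Theorems.FK

namespace IsingLargeDeviations

open MeasureTheory ProbabilityTheory Filter Topology Finset Set
open Literature.Probability.LatticeModels

/-! ### Pure: bounded deviations + concentration ⇒ convergence of the mean -/

/-- **`|∫ X dμ − D| ≤ ε + B·μ{ε ≤ |X − D|}`** for a probability measure `μ`, a measurable `X` with `|X − D| ≤ B` pointwise
and `ε ≥ 0` (split `|X − D| ≤ ε + B·1{ε ≤ |X − D|}`). [cite: Ellis2006, (2.32) and Thm. II.6.3 (proof)] -/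
theorem abs_integral_sub_le_of_abs_sub_le {Ω : Type*} [MeasurableSpace Ω] (μ : Measure Ω) [IsProbabilityMeasure μ]
    {X : Ω → ℝ} (hX : Measurable X) {D B ε : ℝ} (hB : ∀ ω, |X ω - D| ≤ B) (hε : 0 ≤ ε) :
    |∫ ω, X ω ∂μ - D| ≤ ε + B * μ.real {ω | ε ≤ |X ω - D|} := by
  set A : Set Ω := {ω | ε ≤ |X ω - D|} with hA
  have hAm : MeasurableSet A := measurableSet_le measurable_const ((hX.sub_const D).abs)
  have hXint : Integrable X μ := (integrable_const (|D| + B)).mono' hX.aestronglyMeasurable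
    (ae_of_all _ fun ω => by
      rw [Real.norm_eq_abs]
      calc |X ω| = |(X ω - D) + D| := by ring_nf
        _ ≤ |X ω - D| + |D| := abs_add_le _ _
        _ ≤ B + |D| := by linarith [hB ω]
        _ = |D| + B := by ring)
  -- pointwise: `|X − D| ≤ ε + B·1_A`
  have hpt : ∀ ω, |X ω - D| ≤ ε + B * A.indicator 1 ω := by
    intro ω
    by_cases hω : ω ∈ A
    · rw [Set.indicator_of_mem hω, Pi.one_apply, mul_one]; linarith [hB ω]
    · rw [Set.indicator_of_notMem hω, mul_zero, add_zero]
      simp only [hA, mem_setOf_eq, not_le] at hω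
      exact hω.le
  have hBi : Integrable (fun ω => B * A.indicator (1 : Ω → ℝ) ω) μ :=
    ((integrable_const (1 : ℝ)).indicator hAm).const_mul B
  have hind_int : Integrable (fun ω => ε + B * A.indicator (1 : Ω → ℝ) ω) μ := (integrable_const ε).add hBi
  calc |∫ ω, X ω ∂μ - D| = |∫ ω, (X ω - D) ∂μ| := by
        rw [integral_sub hXint (integrable_const D), integral_const, smul_eq_mul, probReal_univ, one_mul]
    _ ≤ ∫ ω, |X ω - D| ∂μ := abs_integral_le_integral_abs
    _ ≤ ∫ ω, (ε + B * A.indicator 1 ω) ∂μ :=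
        integral_mono ((hXint.sub (integrable_const D)).abs) hind_int hpt
    _ = ε + B * μ.real A := by
        rw [integral_add (integrable_const ε) hBi, integral_const, smul_eq_mul, probReal_univ, one_mul,
          integral_const_mul, integral_indicator_one hAm]

/-- **Concentration of bounded deviations forces convergence of the means**: if `|X_N − D| ≤ B` pointwise and for every
`ε > 0` eventually `μ_N{ε ≤ |X_N − D|} ≤ ε`, then `∫ X_N dμ_N → D`. [cite: Ellis2006, (2.32) and Thm. II.6.3] -/
theorem tendsto_integral_of_concentration {Ω : ℕ → Type*} [∀ N, MeasurableSpace (Ω N)] (μ : ∀ N, Measure (Ω N))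
    [∀ N, IsProbabilityMeasure (μ N)] {X : ∀ N, Ω N → ℝ} (hX : ∀ N, Measurable (X N)) {D B : ℝ} (hBnn : 0 ≤ B)
    (hB : ∀ᶠ N : ℕ in atTop, ∀ ω, |X N ω - D| ≤ B)
    (hconc : ∀ ε : ℝ, 0 < ε → ∀ᶠ N : ℕ in atTop, (μ N).real {ω | ε ≤ |X N ω - D|} ≤ ε) :
    Tendsto (fun N => ∫ ω, X N ω ∂μ N) atTop (𝓝 D) := by
  rw [Metric.tendsto_atTop]
  intro ε hε
  set δ : ℝ := ε / (2 * (B + 1)) with hδ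
  have hδpos : 0 < δ := by positivity
  obtain ⟨N₀, hN₀⟩ := ((hconc δ hδpos).and hB).exists_forall_of_atTop
  refine ⟨N₀, fun N hN => ?_⟩
  rw [Real.dist_eq]
  have h1 := abs_integral_sub_le_of_abs_sub_le (μ N) (hX N) (hN₀ N hN).2 hδpos.le
  have h2 := (hN₀ N hN).1
  have h3 : B * (μ N).real {ω | δ ≤ |X N ω - D|} ≤ B * δ := mul_le_mul_of_nonneg_left h2 hBnn
  have hB1 : (0 : ℝ) < B + 1 := by linarith
  calc |∫ ω, X N ω ∂μ N - D| ≤ δ + B * δ := by linarith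
    _ = ε / 2 := by rw [hδ]; field_simp; ring
    _ < ε := by linarith

variable {d : ℕ}

/-- An exponentially small sequence of probabilities is eventually `≤ ε` (`d ≥ 1`: `|Λ_N| → ∞`). [folklore] -/
theorem eventually_exp_neg_mul_card_le (hd : 1 ≤ d) {c : ℝ} (hc : 0 < c) {ε : ℝ} (hε : 0 < ε) :
    ∀ᶠ N : ℕ in atTop, Real.exp (-(c * #(box d N))) ≤ ε := by
  have hcard : Tendsto (fun N : ℕ => (#(box d N) : ℝ)) atTop atTop := by
    refine tendsto_atTop_mono (fun N => ?_) tendsto_natCast_atTop_atTop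
    have h1 : N ≤ #(box d N) := by
      rw [card_box]
      exact (show N ≤ 2 * N + 1 by omega).trans (Nat.le_self_pow (by omega) _)
    exact_mod_cast h1
  have h1 : Tendsto (fun N : ℕ => Real.exp (-(c * (#(box d N) : ℝ)))) atTop (𝓝 0) :=
    Real.tendsto_exp_atBot.comp (tendsto_neg_atTop_atBot.comp (hcard.const_mul_atTop hc))
  exact h1.eventually (eventually_le_nhds hε)

/-! ### The magnetisation density: `|Λ_N|⁻¹ ⟨M_N⟩^{bc} → ∂ψ/∂h / β` for every boundary condition -/

/-- **`|Λ_N|⁻¹ ∫ M_N dμ^{bc}_{Λ_N;β,h} → D/β` FOR EVERY BOUNDARY CONDITION when `HasDerivAt ψ(β,·) D h`** (`β > 0`, `d ≥ 1`):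
exponential concentration (`exp_concentration_of_hasDerivAt`) and the bound `|M_N/|Λ_N| − D/β| ≤ 1 + |D/β|`.
[cite: Ellis2006, (2.32), Thm. II.6.3 and Thm. IV.5.5; FriedliVelenik2017, Cor. 3.44] -/
theorem tendsto_integral_boxMagnetization_of_hasDerivAt (hd : 1 ≤ d) {β : ℝ} (hβ : 0 < β) {h D : ℝ}
    (hD : HasDerivAt (fun t => pressure d β t) D h) (bc : BoundaryCondition (Site d)) :
    Tendsto (fun N : ℕ => (∫ σ, (∑ x ∈ box d N, spinAt x σ) ∂isingMeasure (zdGraph d) (box d N) β h bc) / #(box d N))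
      atTop (𝓝 (D / β)) := by
  have hconv : Tendsto (fun N : ℕ => ∫ σ, (∑ x ∈ box d N, spinAt x σ) / (#(box d N) : ℝ)
      ∂isingMeasure (zdGraph d) (box d N) β h bc) atTop (𝓝 (D / β)) := by
    refine tendsto_integral_of_concentration (fun N => isingMeasure (zdGraph d) (box d N) β h bc)
      (fun N => (measurable_sum_spinAt (box d N)).div_const _) (B := 1 + |D / β|) (by positivity)
      (Eventually.of_forall fun N σ => ?_) fun ε hε => ?_
    · have hV : (0 : ℝ) < #(box d N) := by exact_mod_cast (box_nonempty d N).card_pos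
      have hle : |(∑ x ∈ box d N, spinAt x σ) / (#(box d N) : ℝ)| ≤ 1 := by
        rw [abs_div, abs_of_pos hV, div_le_one hV]
        exact abs_sum_spinAt_le σ (box d N)
      calc |(∑ x ∈ box d N, spinAt x σ) / (#(box d N) : ℝ) - D / β|
          ≤ |(∑ x ∈ box d N, spinAt x σ) / (#(box d N) : ℝ)| + |D / β| := abs_sub _ _
        _ ≤ 1 + |D / β| := by linarith
    · obtain ⟨c, hc, hN⟩ := exp_concentration_of_hasDerivAt hd hβ hD hε
      filter_upwards [hN bc, eventually_exp_neg_mul_card_le hd hc hε] with N h1 h2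
      exact h1.trans h2
  refine hconv.congr fun N => ?_
  rw [integral_div]

/-- **THE BOX-AVERAGED ONE-POINT FUNCTION HAS A BOUNDARY-CONDITION-INDEPENDENT LIMIT**:
`|Λ_N|⁻¹ Σ_{x∈Λ_N} ⟨σ_x⟩^{bc}_{Λ_N;β,h} → D/β` for every `bc` when `HasDerivAt ψ(β,·) D h` (`β > 0`, `d ≥ 1`).
[cite: Ellis2006, (2.32) and Thm. IV.5.5; FriedliVelenik2017, Prop. 3.29 and Cor. 3.44] -/
theorem tendsto_boxAverage_isingCorr_of_hasDerivAt (hd : 1 ≤ d) {β : ℝ} (hβ : 0 < β) {h D : ℝ}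
    (hD : HasDerivAt (fun t => pressure d β t) D h) (bc : BoundaryCondition (Site d)) :
    Tendsto (fun N : ℕ => (∑ x ∈ box d N, isingCorr (zdGraph d) (box d N) β h bc {x}) / #(box d N)) atTop (𝓝 (D / β)) := by
  refine (tendsto_integral_boxMagnetization_of_hasDerivAt hd hβ hD bc).congr fun N => ?_
  congr 1
  rw [integral_finsetSum _ fun x _ => ?_]
  · exact sum_congr rfl fun x _ => by simp only [isingCorr, isingExpect, spinProduct_singleton]
  · exact (integrable_const (1 : ℝ)).mono' (measurable_spinAt x).aestronglyMeasurable
      (ae_of_all _ fun σ => by rw [Real.norm_eq_abs]; exact (abs_spinAt x σ).le)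

/-- **`h > 0`: `|Λ_N|⁻¹ Σ_x ⟨σ_x⟩^{bc}_{Λ_N;β,h} → m(β,h)` for EVERY boundary condition** (`β > 0`, `d ≥ 1`).
[cite: FriedliVelenik2017, Cor. 3.44 and Thm. 3.6; Ellis2006, Thm. V.6.1 (c)] -/
theorem tendsto_boxAverage_isingCorr_pos_field (hd : 1 ≤ d) {β h : ℝ} (hβ : 0 < β) (hh : 0 < h)
    (bc : BoundaryCondition (Site d)) :
    Tendsto (fun N : ℕ => (∑ x ∈ box d N, isingCorr (zdGraph d) (box d N) β h bc {x}) / #(box d N)) atTop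
      (𝓝 (magnetizationInField d β h)) := by
  have h1 := tendsto_boxAverage_isingCorr_of_hasDerivAt hd hβ (IsingSusceptibility.hasDerivAt_pressure_field hd hβ.le hh) bc
  rwa [mul_div_cancel_left₀ _ hβ.ne'] at h1

/-- **`h < 0`: `|Λ_N|⁻¹ Σ_x ⟨σ_x⟩^{bc}_{Λ_N;β,h} → −m(β,−h)` for every boundary condition.** [cite: FriedliVelenik2017, Cor. 3.44 and §3.7.1] -/
theorem tendsto_boxAverage_isingCorr_neg_field (hd : 1 ≤ d) {β h : ℝ} (hβ : 0 < β) (hh : h < 0)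
    (bc : BoundaryCondition (Site d)) :
    Tendsto (fun N : ℕ => (∑ x ∈ box d N, isingCorr (zdGraph d) (box d N) β h bc {x}) / #(box d N)) atTop
      (𝓝 (-magnetizationInField d β (-h))) := by
  have h1 := tendsto_boxAverage_isingCorr_of_hasDerivAt hd hβ
    (IsingSusceptibility.hasDerivAt_pressure_field_of_neg hd hβ.le hh) bc
  rwa [neg_div, mul_div_cancel_left₀ _ hβ.ne'] at h1

/-- **`h = 0`, `m*(β) = 0`: `|Λ_N|⁻¹ Σ_x ⟨σ_x⟩^{bc}_{Λ_N;β,0} → 0` for EVERY boundary condition** (`β > 0`, `d ≥ 1`) — even for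
the `+` boundary condition or any frozen `η`. [cite: FriedliVelenik2017, Thm. 3.34 and Prop. 3.29; Ellis2006, Thm. IV.5.5] -/
theorem tendsto_boxAverage_isingCorr_zero_field_of_spontaneousMagnetization_eq_zero (hd : 1 ≤ d) {β : ℝ} (hβ : 0 < β)
    (hm : spontaneousMagnetization d β = 0) (bc : BoundaryCondition (Site d)) :
    Tendsto (fun N : ℕ => (∑ x ∈ box d N, isingCorr (zdGraph d) (box d N) β 0 bc {x}) / #(box d N)) atTop (𝓝 0) := by
  have hdiff := (IsingSusceptibility.differentiableAt_pressure_zero_iff hd hβ).2 hm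
  have hR := IsingSusceptibility.hasDerivWithinAt_pressure_field_zero (d := d) hd hβ.le
  have hderiv : deriv (fun t => pressure d β t) 0 = β * spontaneousMagnetization d β :=
    (uniqueDiffOn_Ici (0 : ℝ) 0 self_mem_Ici).eq_deriv _ hdiff.hasDerivAt.hasDerivWithinAt hR
  have h1 := tendsto_boxAverage_isingCorr_of_hasDerivAt hd hβ hdiff.hasDerivAt bc
  rwa [hderiv, hm, mul_zero, zero_div] at h1

/-- **`d ≥ 2`, `h = 0`, `0 < β ≤ β_c(d)`: the box-averaged magnetisation of EVERY boundary condition tends to `0`.**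
[cite: FriedliVelenik2017, Thm. 3.25 and Thm. 3.34] -/
theorem tendsto_boxAverage_isingCorr_zero_field_of_le_criticalBeta (hd : 2 ≤ d) {β : ℝ} (hβ : 0 < β)
    (hβc : β ≤ criticalBeta d) (bc : BoundaryCondition (Site d)) :
    Tendsto (fun N : ℕ => (∑ x ∈ box d N, isingCorr (zdGraph d) (box d N) β 0 bc {x}) / #(box d N)) atTop (𝓝 0) :=
  tendsto_boxAverage_isingCorr_zero_field_of_spontaneousMagnetization_eq_zero (by omega) hβ
    (IsingSusceptibility.spontaneousMagnetization_eq_zero_of_hasUniqueGibbsMeasure (d := d) hβ.le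
      ((IsingSusceptibility.hasUniqueGibbsMeasure_zero_field_iff hd hβ).2 hβc)) bc

/-- **In the uniqueness region `|𝒢(β,h)| = 1`: `|Λ_N|⁻¹ Σ_x ⟨σ_x⟩^{bc}_{Λ_N;β,h} → sign(h)·m(β,|h|)` for every boundary condition**
(`β > 0`, `d ≥ 1`). [cite: FriedliVelenik2017, Thm. 3.34 and Cor. 3.44; Ellis2006, Thm. V.6.1 (c)] -/
theorem tendsto_boxAverage_isingCorr_of_hasUniqueGibbsMeasure (hd : 1 ≤ d) {β : ℝ} (hβ : 0 < β) {h : ℝ}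
    (hU : HasUniqueGibbsMeasure (isingSpecification (zdGraph d) β h)) (bc : BoundaryCondition (Site d)) :
    Tendsto (fun N : ℕ => (∑ x ∈ box d N, isingCorr (zdGraph d) (box d N) β h bc {x}) / #(box d N)) atTop
      (𝓝 (Real.sign h * magnetizationInField d β |h|)) := by
  rcases lt_trichotomy h 0 with hneg | rfl | hpos
  · rw [Real.sign_of_neg hneg, abs_of_neg hneg, neg_one_mul]
    exact tendsto_boxAverage_isingCorr_neg_field hd hβ hneg bc
  · rw [Real.sign_zero, zero_mul]
    exact tendsto_boxAverage_isingCorr_zero_field_of_spontaneousMagnetization_eq_zero hd hβ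
      (IsingSusceptibility.spontaneousMagnetization_eq_zero_of_hasUniqueGibbsMeasure (d := d) hβ.le hU) bc
  · rw [Real.sign_of_pos hpos, abs_of_pos hpos, one_mul]
    exact tendsto_boxAverage_isingCorr_pos_field hd hβ hpos bc

/-! ### The energy density: `|Λ_N|⁻¹ ⟨−H_N⟩^{bc} → ∂ψ/∂β` for every boundary condition -/

/-- **`|Λ_N|⁻¹ ∫ (−H_N) dμ^{bc}_{Λ_N;β,h} → D` FOR EVERY BOUNDARY CONDITION when `HasDerivAt ψ(·,h) D β`** (`d ≥ 1`):
exponential concentration (`energy_exp_concentration_of_hasDerivAt`) and the a-priori bound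
`|H_N| ≤ |ℰ^b_{Λ_N}| + |h||Λ_N| ≤ (2d + 1 + |h|)|Λ_N|`-type boundedness (`|ℰ^b_Λ| ≤ |ℰ_Λ| + |∂ᵉΛ|`, both `O(|Λ|)` on boxes).
[cite: Ellis2006, (2.32), Thm. II.6.3 and §IV.7; FriedliVelenik2017, Thm. 3.6 and Exercise 3.17] -/
theorem tendsto_integral_energyDensity_of_hasDerivAt (hd : 1 ≤ d) {β h D : ℝ}
    (hD : HasDerivAt (fun b => pressure d b h) D β) (bc : BoundaryCondition (Site d)) :
    Tendsto (fun N : ℕ => (∫ σ, (-isingHamiltonian (zdGraph d) (box d N) h bc σ)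
      ∂isingMeasure (zdGraph d) (box d N) β h bc) / #(box d N)) atTop (𝓝 D) := by
  -- a uniform bound `B` on `|−H_N/|Λ_N| − D|`: `|ℰ^b_{Λ_N}|/|Λ_N| ≤ d + 1` eventually would do; we use the crude
  -- `|ℰ^b_Λ| ≤ |ℰ_Λ| + |∂ᵉΛ|` with `|ℰ_{Λ_N}|/|Λ_N| → d` and `|∂ᵉΛ_N|/|Λ_N| → 0`, so both ratios are eventually `≤ d + 1`.
  have hE : ∀ᶠ N : ℕ in atTop, (#(edgesTouching (zdGraph d) (box d N)) : ℝ) ≤ (2 * d + 2) * #(box d N) := by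
    have h1 : ∀ᶠ N : ℕ in atTop, (#(edgesIn (zdGraph d) (box d N)) : ℝ) / #(box d N) < d + 1 :=
      (tendsto_card_edgesIn_box_div_card_box (d := d)).eventually (gt_mem_nhds (by linarith))
    have h2 : ∀ᶠ N : ℕ in atTop, (#(edgeBoundary (zdGraph d) (box d N)) : ℝ) / #(box d N) < d + 1 :=
      (tendsto_card_edgeBoundary_box_div d).eventually (gt_mem_nhds (by positivity))
    filter_upwards [h1, h2] with N h1 h2
    have hV : (0 : ℝ) < #(box d N) := by exact_mod_cast (box_nonempty d N).card_pos
    rw [div_lt_iff₀ hV] at h1 h2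
    have hsub : edgesTouching (zdGraph d) (box d N) ⊆ edgesIn (zdGraph d) (box d N) ∪ edgeBoundary (zdGraph d) (box d N) := by
      intro e he
      rw [Finset.mem_union]
      by_cases hin : e ∈ edgesIn (zdGraph d) (box d N)
      · exact Or.inl hin
      · exact Or.inr (Finset.mem_sdiff.2 ⟨he, hin⟩)
    have hcard : (#(edgesTouching (zdGraph d) (box d N)) : ℝ) ≤
        #(edgesIn (zdGraph d) (box d N)) + #(edgeBoundary (zdGraph d) (box d N)) := by
      exact_mod_cast (Finset.card_le_card hsub).trans (Finset.card_union_le _ _)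
    linarith
  have hconv : Tendsto (fun N : ℕ => ∫ σ, (-isingHamiltonian (zdGraph d) (box d N) h bc σ) / (#(box d N) : ℝ)
      ∂isingMeasure (zdGraph d) (box d N) β h bc) atTop (𝓝 D) := by
    refine tendsto_integral_of_concentration (fun N => isingMeasure (zdGraph d) (box d N) β h bc)
      (fun N => ((measurable_isingHamiltonian (zdGraph d) (box d N) h bc).neg).div_const _)
      (B := 2 * d + 2 + |h| + |D|) (by positivity) ?_ fun ε hε => ?_
    · filter_upwards [hE] with N hN σ
      have hV : (0 : ℝ) < #(box d N) := by exact_mod_cast (box_nonempty d N).card_pos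
      have h1 : |(-isingHamiltonian (zdGraph d) (box d N) h bc σ) / (#(box d N) : ℝ)| ≤ 2 * d + 2 + |h| := by
        rw [abs_div, abs_of_pos hV, div_le_iff₀ hV, abs_neg]
        calc |isingHamiltonian (zdGraph d) (box d N) h bc σ|
            ≤ #(edgesTouching (zdGraph d) (box d N)) + |h| * #(box d N) := abs_isingHamiltonian_le _ _ h bc σ
          _ ≤ (2 * d + 2) * #(box d N) + |h| * #(box d N) := by linarith
          _ = (2 * d + 2 + |h|) * #(box d N) := by ring
      calc |(-isingHamiltonian (zdGraph d) (box d N) h bc σ) / (#(box d N) : ℝ) - D|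
          ≤ |(-isingHamiltonian (zdGraph d) (box d N) h bc σ) / (#(box d N) : ℝ)| + |D| := abs_sub _ _
        _ ≤ 2 * d + 2 + |h| + |D| := by linarith
    · obtain ⟨c, hc, hN⟩ := energy_exp_concentration_of_hasDerivAt hd hD hε
      filter_upwards [hN bc, eventually_exp_neg_mul_card_le hd hc hε] with N h1 h2
      exact h1.trans h2
  refine hconv.congr fun N => ?_
  rw [integral_div]

/-- **`h = 0`, `0 < β ≤ β_c(d)`, `d ≥ 2`: the mean energy density of EVERY boundary condition converges to the `+`-state
nearest-neighbour energy `Σᵢ⟨σ_0σ_{eᵢ}⟩⁺_β`** (including AT `β_c`: no latent heat). [cite: FriedliVelenik2017, Exercise 3.17 and Thm. 3.6; AizenmanDuminilCopinSidoraviciusCMP2015, Thm. 1.3] -/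
theorem tendsto_integral_energyDensity_of_le_criticalBeta (hd : 2 ≤ d) {β : ℝ} (hβ : 0 < β) (hβc : β ≤ criticalBeta d)
    (bc : BoundaryCondition (Site d)) :
    Tendsto (fun N : ℕ => (∫ σ, (-isingHamiltonian (zdGraph d) (box d N) 0 bc σ)
      ∂isingMeasure (zdGraph d) (box d N) β 0 bc) / #(box d N)) atTop (𝓝 (∑ i, plusCorr d β 0 {0, Pi.single i 1})) :=
  tendsto_integral_energyDensity_of_hasDerivAt (by omega)
    (IsingEnergyDensity.hasDerivAt_pressure_beta_of_le_criticalBeta (d := d) hd hβ hβc) bc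

/-- **AT `β_c` (`d ≥ 2`, `h = 0`): `|Λ_N|⁻¹ ⟨−H_N⟩^{bc}_{Λ_N;β_c,0} → Σᵢ⟨σ_0σ_{eᵢ}⟩⁺_{β_c}` for EVERY boundary condition** — the critical
energy density does not depend on the boundary condition (no latent heat). [cite: AizenmanDuminilCopinSidoraviciusCMP2015, Thm. 1.3; FriedliVelenik2017, Thm. 3.6] -/
theorem tendsto_integral_energyDensity_criticalBeta (hd : 2 ≤ d) (bc : BoundaryCondition (Site d)) :
    Tendsto (fun N : ℕ => (∫ σ, (-isingHamiltonian (zdGraph d) (box d N) 0 bc σ)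
      ∂isingMeasure (zdGraph d) (box d N) (criticalBeta d) 0 bc) / #(box d N)) atTop
      (𝓝 (∑ i, plusCorr d (criticalBeta d) 0 {0, Pi.single i 1})) :=
  tendsto_integral_energyDensity_of_hasDerivAt (by omega)
    (IsingEnergyDensity.hasDerivAt_pressure_beta_criticalBeta (d := d) hd) bc

/-- **`h > 0`, every `β > 0` (`d ≥ 1`): `|Λ_N|⁻¹ ⟨−H_N⟩^{bc}_{Λ_N;β,h} → Σᵢ⟨σ_0σ_{eᵢ}⟩⁺_{β,h} + h m(β,h)` for every boundary
condition.** [cite: FriedliVelenik2017, Thm. 3.6 and Cor. 3.44; Ellis2006, Thm. V.6.1 (c)] -/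
theorem tendsto_integral_energyDensity_pos_field (hd : 1 ≤ d) {β h : ℝ} (hβ : 0 < β) (hh : 0 < h)
    (bc : BoundaryCondition (Site d)) :
    Tendsto (fun N : ℕ => (∫ σ, (-isingHamiltonian (zdGraph d) (box d N) h bc σ)
      ∂isingMeasure (zdGraph d) (box d N) β h bc) / #(box d N)) atTop
      (𝓝 (∑ i, plusCorr d β h {0, Pi.single i 1} + h * magnetizationInField d β h)) :=
  tendsto_integral_energyDensity_of_hasDerivAt hd (IsingEnergyDensity.hasDerivAt_pressure_beta_of_pos_field (d := d) hd hβ hh) bc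

/-- **`d = 2`, every `β > 0`, `h = 0`: `|Λ_N|⁻¹ ⟨−H_N⟩^{bc}_{Λ_N;β,0} → Σᵢ⟨σ_0σ_{eᵢ}⟩⁺_β` for every boundary condition.**
[cite: FriedliVelenik2017, Thm. 3.6 and Exercise 3.17] -/
theorem tendsto_integral_energyDensity_two {β : ℝ} (hβ : 0 < β) (bc : BoundaryCondition (Site 2)) :
    Tendsto (fun N : ℕ => (∫ σ, (-isingHamiltonian (zdGraph 2) (box 2 N) 0 bc σ)
      ∂isingMeasure (zdGraph 2) (box 2 N) β 0 bc) / #(box 2 N)) atTop (𝓝 (∑ i, plusCorr 2 β 0 {0, Pi.single i 1})) :=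
  tendsto_integral_energyDensity_of_hasDerivAt (by norm_num) (IsingEnergyDensity.hasDerivAt_pressure_beta_two hβ) bc

end IsingLargeDeviations

end Summit.CriticalPhenomena.PercolationContinuityZ3.Theorems.FK
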